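import Summits.CriticalPhenomena.PercolationContinuityZ3.Theorems.PercNearOneGluingNoHeavyLowerTailAPLVwEasy
import HarnessLib

/-!
# `NoHeavyLowerTail` (stmt-CriticalPhenomena-4575) — (PV-signed) is a block-local statement:
# the apex form `H2`, its equivalence with (PV-signed), and exact sum-of-squares identities for
# series composition (cut vertices) and for an extra apex edge

Support file (prover prim-ineq-gen-8 gen 45; `--supports stmt-CriticalPhenomena-4575`; memo
run/shared/lean/prim/prim-ineq-gen-8/FINDING-gen45-SERIES.md).  No definitions, no named facts, no sorries.

SETTING (as in `…APLVwEasy.lean`: a single glued apex `s`, a second vertex `v`, SIGNED loads `ℓ : V → ℝ`).  Write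
`U = ℓ(C_s)`, `W = ℓ(C_v)` and, in the event sums of that file,
  `a = Σ_x ℓ_x μ(s↔x) = E U`,  `b = Σ_y ℓ_y μ(v↔y) = E W`,  `π̄ = Σ_y ℓ_y μ(s↔v ∩ s↔y) = E[U; s↔v]`,
  `σ̄ = Σ_y ℓ_y μ(v↔y ∩ s↮v) = E[W; s↮v] = b − π̄`,  `E = Σ_{x,y} ℓ_xℓ_y μ(s↔x ∩ v↔y ∩ s↮v) = E[UW; s↮v]`,  `p_v = μ(s↔v)`.
Gen 44 isolated the per-vertex target (PV) `N² ≤ 2 p_v Γ` (`N = π̄ − p_v a = Cov(1[s↔v],U)`, `Γ = aσ̄ − E = −Cov(U, 1[s↮v]W)`),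
which for signed loads is the conjecture (PV-signed) (`2p_v·Sym K ⪰ c cᵀ`, 0 failures in > 5·10⁶ exact cases), and the apex-free
master form (N1) `E ≤ a·b`.

THIS FILE (pure real algebra + one percolation wrapper) puts the following structure in the kernel. [this work]
* The APEX FORM `H2`: `2 p_v (a b − E) ≥ π̄²`, i.e. the bordered matrix `[[2S, p],[pᵀ, p_v]] ⪰ 0` (`S` the (N1) matrix,
  `p_x = μ(x↔s↔v)`).  `pvs_eq_h2_sub`: `2p_vΓ − N² = H2 − p_v² a²`; `h2_apex_shift`: a load `t` moved onto the apex turns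
  `H2` into `H2 − p_v²a² + p_v²(t+a)²`.  Hence (PV-signed) at `ℓ` ⟺ `H2` at `ℓ + t·δ_s` for all real `t`
  (`pv_signed_of_h2_alg`, `h2_of_pv_signed_alg`); in particular `H2 ⟹ (PV)` WITH THE SHARP CONSTANT 2 (gen 44 had
  (N1) ⟹ (PV) with constant 4, `pv_four_of_n1_alg`).  Percolation form: `pv_signed_of_h2`.
* TERMINAL LOADS (`h2_terminal_shift`): moving loads onto the two terminals changes `h := 2p_v(ab−E) − π̄²` by an explicit
  quadratic, and `(1−p_v²)·h − p_v²(a² + b² − 2p_v ab)` is INVARIANT; so "`H2` for all terminal loads" is the single Schur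
  inequality `(1 − p_v²) h ≥ p_v² (a² + b² − 2 p_v a b)` (`h2_schur_of_forall`).
* SERIES COMPOSITION (`h2_series_identity`, `h2_series`): glue `(H₁; y,u)` and `(H₂; u,v)` at a cut vertex `u` (load `r`).
  With `τ = τ₁τ₂` and the elementary composition rules for `(a, b, π̄, E)` recorded in the docstring (independence of the two
  sides; memo §2, machine-checked against brute force), the composite `h` times `(1−τ₁²)(1−τ₂²)` is the sum of the two pieces'
  Schur forms and three explicit squares — an exact SOS identity.  Hence `H2` (≡ (PV-signed)) for the blocks implies it for
  the glued graph: (PV-signed) REDUCES TO 2-CONNECTED two-terminal graphs (pendant subgraphs are load shifts, memo §2c), and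
  holds on every graph whose `s–v` block chain consists of `H2` blocks (all forests; the class of memo §3).
* APEX EDGE (`h2_parallel_edge_identity`, `h2_parallel_edge`): an extra edge of weight `z` between the terminals maps `h ↦ h'`
  by another exact SOS identity with explicit nonnegative polynomial weights `α, G` in `(τ, z)`; `H2` survives apex edges.
NOT here: the composition rules as kernel statements about `prodBernoulli` on a glued vertex type (elementary, but they need a
gluing formalism); general parallel composition of two non-edge pieces — memo §4: `H2` is NOT closed under it for abstract data,
which is exactly where the 2-connected case lives.
-/

noncomputable section

namespace Summit.CriticalPhenomena.PercolationContinuityZ3.Theorems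

namespace APL

open MeasureTheory Set Finset Literature.Probability.Percolation Literature.Probability.LatticeModels
open scoped Classical BigOperators

/-! ### The apex form `H2` versus (PV-signed): algebra in the scalars `(p_v, a, b, π̄, E)` -/

/-- **`2p_vΓ − N² = H2 − p_v²a²`.**  With `N = π̄ − p_v a`, `Γ = a(b − π̄) − E` and `H2 := 2p_v(ab − E) − π̄²`:
`2 p_v Γ − N² = H2 − p_v² a²` — (PV-signed) at a load is the apex form minus the square `p_v²(E U)²`. [this work] -/
theorem pvs_eq_h2_sub (pv a b pib E : ℝ) :
    2 * pv * (a * (b - pib) - E) - (pib - pv * a) ^ 2 = (2 * pv * (a * b - E) - pib ^ 2) - pv ^ 2 * a ^ 2 := by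
  ring

/-- **Apex-load shift.**  An extra load `t` on the glued apex replaces `(a, b, π̄, E)` by
`(a + t, b + p_v t, π̄ + p_v t, E + t(b − π̄))` (the apex lies in `C_s` always and in `C_v` iff `s↔v`), and
`H2(t) = H2 − p_v²a² + p_v²(t + a)²`. [this work] -/
theorem h2_apex_shift (pv a b pib E t : ℝ) :
    2 * pv * ((a + t) * (b + pv * t) - (E + t * (b - pib))) - (pib + pv * t) ^ 2 =
      (2 * pv * (a * b - E) - pib ^ 2) - pv ^ 2 * a ^ 2 + pv ^ 2 * (t + a) ^ 2 := by
  ring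

/-- **`H2` for every apex load ⟹ (PV-signed)** (algebra, in the event-sum form of `pv_four_of_n1_alg`).  If for every real
`t`, `(π̄ + t p_v)² ≤ 2 p_v ((a+t)(π̄ + σ̄ + t p_v) − E − tσ̄)` — `H2` for the loads `ℓ` plus `t` on the apex, `b = π̄ + σ̄` —
then `N² ≤ 2 p_v Γ` with `N = Σ_x ℓ_x(π_x − p_v p_x)`, `Γ = Σ_{x,y} ℓ_xℓ_y(p_xσ_y − ρ_{xy})`: (PV) with the sharp constant
`2` for SIGNED loads.  Proof: `t = −a`. [this work] -/
theorem pv_signed_of_h2_alg {ι : Type*} (U : Finset ι) (ℓ p π σ : ι → ℝ) (ρ : ι → ι → ℝ) (pv : ℝ)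
    (hH2 : ∀ t : ℝ, ((∑ y ∈ U, ℓ y * π y) + t * pv) ^ 2 ≤
      2 * pv * ((((∑ x ∈ U, ℓ x * p x) + t) * ((∑ y ∈ U, ℓ y * π y) + (∑ y ∈ U, ℓ y * σ y) + t * pv))
        - (∑ x ∈ U, ∑ y ∈ U, ℓ x * ℓ y * ρ x y) - t * ∑ y ∈ U, ℓ y * σ y)) :
    (∑ x ∈ U, ℓ x * (π x - pv * p x)) ^ 2 ≤
      2 * pv * ∑ x ∈ U, ∑ y ∈ U, ℓ x * ℓ y * (p x * σ y - ρ x y) := by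
  set a := ∑ x ∈ U, ℓ x * p x with ha
  set pb := ∑ y ∈ U, ℓ y * π y with hpb
  set s := ∑ y ∈ U, ℓ y * σ y with hs
  set E := ∑ x ∈ U, ∑ y ∈ U, ℓ x * ℓ y * ρ x y with hE
  have hNeq : ∑ x ∈ U, ℓ x * (π x - pv * p x) = pb - pv * a := by
    rw [hpb, ha, Finset.mul_sum, ← Finset.sum_sub_distrib]
    refine Finset.sum_congr rfl fun x _ => ?_
    ring
  have hΓeq : ∑ x ∈ U, ∑ y ∈ U, ℓ x * ℓ y * (p x * σ y - ρ x y) = a * s - E := by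
    rw [ha, hs, hE, Finset.sum_mul_sum, ← Finset.sum_sub_distrib]
    refine Finset.sum_congr rfl fun x _ => ?_
    rw [← Finset.sum_sub_distrib]
    refine Finset.sum_congr rfl fun y _ => ?_
    ring
  have h := hH2 (-a)
  rw [hNeq, hΓeq]
  nlinarith [h]

/-- **(PV-signed) ⟹ `H2` for every apex load** (converse, algebra): if `(π̄ − p_v a)² ≤ 2p_v(aσ̄ − E)` then for every real
`t`, `(π̄ + tp_v)² ≤ 2p_v((a+t)(π̄+σ̄+tp_v) − E − tσ̄)`.  So, load by load, (PV-signed) at `ℓ` is `H2` at all `ℓ + tδ_s`.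
[this work] -/
theorem h2_of_pv_signed_alg (pv a pib sg E : ℝ) (hpvs : (pib - pv * a) ^ 2 ≤ 2 * pv * (a * sg - E)) (t : ℝ) :
    (pib + t * pv) ^ 2 ≤ 2 * pv * ((a + t) * (pib + sg + t * pv) - E - t * sg) := by
  nlinarith [hpvs, sq_nonneg (pv * (t + a))]

/-! ### Terminal loads and the Schur form -/

/-- **Terminal-load shift.**  Two-terminal notation: `τ = p_v`, `P = E U`, `Q = E W`, `c = E[U; s↔v]`, `d = E[UW; s↮v]`.
Extra loads `s₀` (on the apex) and `t₀` (on `v`) give `P' = P + s₀ + τt₀`, `Q' = Q + t₀ + τs₀`, `c' = c + τ(s₀+t₀)`,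
`d' = d + s₀(Q − c) + t₀(P − c) + (1−τ)s₀t₀`; the apex form `h = 2τ(PQ − d) − c²` then satisfies:
`(1−τ²)h' − τ²(P'² + Q'² − 2τP'Q') = (1−τ²)h − τ²(P² + Q² − 2τPQ)` (an invariant). [this work] -/
theorem h2_terminal_shift (τ P Q c d s₀ t₀ : ℝ) :
    (1 - τ ^ 2) * (2 * τ * ((P + s₀ + τ * t₀) * (Q + t₀ + τ * s₀) - (d + s₀ * (Q - c) + t₀ * (P - c) + (1 - τ) * s₀ * t₀))
        - (c + τ * (s₀ + t₀)) ^ 2)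
      - τ ^ 2 * ((P + s₀ + τ * t₀) ^ 2 + (Q + t₀ + τ * s₀) ^ 2 - 2 * τ * (P + s₀ + τ * t₀) * (Q + t₀ + τ * s₀)) =
    (1 - τ ^ 2) * (2 * τ * (P * Q - d) - c ^ 2) - τ ^ 2 * (P ^ 2 + Q ^ 2 - 2 * τ * P * Q) := by
  ring

/-- **Schur form of `H2`.**  If `τ² < 1` and the apex form is nonnegative for ALL terminal loads, then
`τ²(P² + Q² − 2τPQ) ≤ (1 − τ²)(2τ(PQ − d) − c²)` (use the terminal loads making `P' = Q' = 0`).  In matrix terms this is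
the Schur complement of the bordered matrix `[[2S,p],[pᵀ,τ]]` with respect to its `{s,v}` block `τ[[2,1+τ],[1+τ,2]]`.
[this work] -/
theorem h2_schur_of_forall (τ P Q c d : ℝ) (hτ : τ ^ 2 < 1)
    (hall : ∀ s₀ t₀ : ℝ, 0 ≤ 2 * τ * ((P + s₀ + τ * t₀) * (Q + t₀ + τ * s₀) -
        (d + s₀ * (Q - c) + t₀ * (P - c) + (1 - τ) * s₀ * t₀)) - (c + τ * (s₀ + t₀)) ^ 2) :
    τ ^ 2 * (P ^ 2 + Q ^ 2 - 2 * τ * P * Q) ≤ (1 - τ ^ 2) * (2 * τ * (P * Q - d) - c ^ 2) := by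
  have hpos : 0 < 1 - τ ^ 2 := by linarith
  have hne : (1 - τ ^ 2) ≠ 0 := ne_of_gt hpos
  set s₀ := -(P - τ * Q) / (1 - τ ^ 2) with hs₀
  set t₀ := -(Q - τ * P) / (1 - τ ^ 2) with ht₀
  have hP : P + s₀ + τ * t₀ = 0 := by
    rw [hs₀, ht₀]
    field_simp
    ring
  have hQ : Q + t₀ + τ * s₀ = 0 := by
    rw [hs₀, ht₀]
    field_simp
    ring
  have hid := h2_terminal_shift τ P Q c d s₀ t₀
  have h0 := hall s₀ t₀
  have h1 : 0 ≤ (1 - τ ^ 2) * (2 * τ * ((P + s₀ + τ * t₀) * (Q + t₀ + τ * s₀) -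
        (d + s₀ * (Q - c) + t₀ * (P - c) + (1 - τ) * s₀ * t₀)) - (c + τ * (s₀ + t₀)) ^ 2) :=
    mul_nonneg hpos.le h0
  rw [hP, hQ] at hid h1
  have hsq : τ ^ 2 * ((0:ℝ) ^ 2 + 0 ^ 2 - 2 * τ * 0 * 0) = 0 := by ring
  linarith [hid, h1, hsq]

/-! ### Series composition at a cut vertex: an exact SOS identity -/

/-- **Series identity.**  Two-terminal pieces `(H₁; y,u)` — scalars `τ₁, P₁ = E U₁, Q₁ = E W₁, c₁ = E[U₁; y↔u],
d₁ = E[U₁W₁; y↮u]`, at terminal loads `s` on `y`, `r` on `u` — and `(H₂; u,v)` — `τ₂, P₂, Q₂, c₂, d₂` at loads `r` on `u`,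
`t` on `v` — glued at the cut vertex `u`.  By independence of the two sides the glued `(G; y,v)` has `τ = τ₁τ₂`,
`E U = P₁ + τ₁(P₂ − r)`, `E W = Q₂ + τ₂(Q₁ − r)`, `c = τ₂c₁ + τ₁c₂ − rτ₁τ₂`,
`d = (P₁−c₁)(Q₂−c₂) + (c₁−rτ₁)(Q₂−c₂) + τ₁d₂ + (c₂−rτ₂)(P₁−c₁) + τ₂d₁` (memo §2a; checked there against brute-force
enumeration).  THEN `(1−τ₁²)(1−τ₂²)·(apex form of G)` is the weighted sum of the two pieces' Schur forms plus three squares: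
[this work] -/
theorem h2_series_identity (τ₁ τ₂ P₁ Q₁ c₁ d₁ P₂ Q₂ c₂ d₂ r : ℝ) :
    (1 - τ₁ ^ 2) * (1 - τ₂ ^ 2) *
      (2 * (τ₁ * τ₂) * ((P₁ + τ₁ * (P₂ - r)) * (Q₂ + τ₂ * (Q₁ - r)) -
          ((P₁ - c₁) * (Q₂ - c₂) + (c₁ - r * τ₁) * (Q₂ - c₂) + τ₁ * d₂ + (c₂ - r * τ₂) * (P₁ - c₁) + τ₂ * d₁))
        - (τ₂ * c₁ + τ₁ * c₂ - r * τ₁ * τ₂) ^ 2) =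
    τ₂ ^ 2 * (1 - τ₂ ^ 2) *
        ((1 - τ₁ ^ 2) * (2 * τ₁ * (P₁ * Q₁ - d₁) - c₁ ^ 2) - τ₁ ^ 2 * (P₁ ^ 2 + Q₁ ^ 2 - 2 * τ₁ * P₁ * Q₁))
    + τ₁ ^ 2 * (1 - τ₁ ^ 2) *
        ((1 - τ₂ ^ 2) * (2 * τ₂ * (P₂ * Q₂ - d₂) - c₂ ^ 2) - τ₂ ^ 2 * (P₂ ^ 2 + Q₂ ^ 2 - 2 * τ₂ * P₂ * Q₂))
    + τ₁ ^ 2 * τ₂ ^ 2 * ((1 - τ₁ ^ 2) * (1 - τ₂ ^ 2) * (r - P₂ - Q₁) ^ 2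
        + (1 - τ₂ ^ 2) * (P₁ - τ₁ * Q₁) ^ 2 + (1 - τ₁ ^ 2) * (Q₂ - τ₂ * P₂) ^ 2) := by
  ring

/-- **`H2` is preserved by series composition.**  If both pieces satisfy the Schur form of `H2` (`h2_schur_of_forall`, i.e.
`H2` for all their terminal loads) and `τ₁², τ₂² < 1`, then the glued two-terminal graph satisfies `H2` at the given loads
(and therefore, the hypotheses being load-free, at all loads):
`(τ₂c₁ + τ₁c₂ − rτ₁τ₂)² ≤ 2τ₁τ₂·(E U · E W − d)`.  Consequence (memo §2): (PV-signed) reduces to the 2-connected blocks of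
the `s–v` block chain; it holds whenever each block satisfies it. [this work] -/
theorem h2_series (τ₁ τ₂ P₁ Q₁ c₁ d₁ P₂ Q₂ c₂ d₂ r : ℝ) (hτ₁ : τ₁ ^ 2 < 1) (hτ₂ : τ₂ ^ 2 < 1)
    (h₁ : τ₁ ^ 2 * (P₁ ^ 2 + Q₁ ^ 2 - 2 * τ₁ * P₁ * Q₁) ≤ (1 - τ₁ ^ 2) * (2 * τ₁ * (P₁ * Q₁ - d₁) - c₁ ^ 2))
    (h₂ : τ₂ ^ 2 * (P₂ ^ 2 + Q₂ ^ 2 - 2 * τ₂ * P₂ * Q₂) ≤ (1 - τ₂ ^ 2) * (2 * τ₂ * (P₂ * Q₂ - d₂) - c₂ ^ 2)) :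
    (τ₂ * c₁ + τ₁ * c₂ - r * τ₁ * τ₂) ^ 2 ≤
      2 * (τ₁ * τ₂) * ((P₁ + τ₁ * (P₂ - r)) * (Q₂ + τ₂ * (Q₁ - r)) -
        ((P₁ - c₁) * (Q₂ - c₂) + (c₁ - r * τ₁) * (Q₂ - c₂) + τ₁ * d₂ + (c₂ - r * τ₂) * (P₁ - c₁) + τ₂ * d₁)) := by
  have hid := h2_series_identity τ₁ τ₂ P₁ Q₁ c₁ d₁ P₂ Q₂ c₂ d₂ r
  have hA : 0 < 1 - τ₁ ^ 2 := by linarith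
  have hB : 0 < 1 - τ₂ ^ 2 := by linarith
  set X := 2 * (τ₁ * τ₂) * ((P₁ + τ₁ * (P₂ - r)) * (Q₂ + τ₂ * (Q₁ - r)) -
        ((P₁ - c₁) * (Q₂ - c₂) + (c₁ - r * τ₁) * (Q₂ - c₂) + τ₁ * d₂ + (c₂ - r * τ₂) * (P₁ - c₁) + τ₂ * d₁))
      - (τ₂ * c₁ + τ₁ * c₂ - r * τ₁ * τ₂) ^ 2 with hX
  set S₁ := (1 - τ₁ ^ 2) * (2 * τ₁ * (P₁ * Q₁ - d₁) - c₁ ^ 2) - τ₁ ^ 2 * (P₁ ^ 2 + Q₁ ^ 2 - 2 * τ₁ * P₁ * Q₁) with hS₁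
  set S₂ := (1 - τ₂ ^ 2) * (2 * τ₂ * (P₂ * Q₂ - d₂) - c₂ ^ 2) - τ₂ ^ 2 * (P₂ ^ 2 + Q₂ ^ 2 - 2 * τ₂ * P₂ * Q₂) with hS₂
  have hs₁ : 0 ≤ S₁ := by rw [hS₁]; linarith
  have hs₂ : 0 ≤ S₂ := by rw [hS₂]; linarith
  have t1 : 0 ≤ τ₂ ^ 2 * (1 - τ₂ ^ 2) * S₁ := mul_nonneg (mul_nonneg (sq_nonneg _) hB.le) hs₁
  have t2 : 0 ≤ τ₁ ^ 2 * (1 - τ₁ ^ 2) * S₂ := mul_nonneg (mul_nonneg (sq_nonneg _) hA.le) hs₂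
  have t3 : 0 ≤ τ₁ ^ 2 * τ₂ ^ 2 * ((1 - τ₁ ^ 2) * (1 - τ₂ ^ 2) * (r - P₂ - Q₁) ^ 2
      + (1 - τ₂ ^ 2) * (P₁ - τ₁ * Q₁) ^ 2 + (1 - τ₁ ^ 2) * (Q₂ - τ₂ * P₂) ^ 2) := by
    have h3 : 0 ≤ (1 - τ₁ ^ 2) * (1 - τ₂ ^ 2) * (r - P₂ - Q₁) ^ 2
        + (1 - τ₂ ^ 2) * (P₁ - τ₁ * Q₁) ^ 2 + (1 - τ₁ ^ 2) * (Q₂ - τ₂ * P₂) ^ 2 := by positivity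
    exact mul_nonneg (mul_nonneg (sq_nonneg _) (sq_nonneg _)) h3
  have hprod : 0 ≤ (1 - τ₁ ^ 2) * (1 - τ₂ ^ 2) * X := by rw [hid]; linarith
  have hAB : 0 < (1 - τ₁ ^ 2) * (1 - τ₂ ^ 2) := mul_pos hA hB
  have hX0 : 0 ≤ X := by
    by_contra hneg
    have hlt : X < 0 := lt_of_not_ge hneg
    have := mul_neg_of_pos_of_neg hAB hlt
    linarith
  rw [hX] at hX0
  linarith

/-! ### An extra edge between the terminals: a second exact SOS identity -/

/-- **Apex-edge identity.**  Two-terminal piece `(H; y,v)` with scalars `τ, P, Q, c, d` (apex form `h = 2τ(PQ−d) − c²`,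
`μ := Q − c = E[W; y↮v]`, `ν := P − c = E[U; y↮v]`), plus an extra edge `y–v` of weight `z`.  The new two-terminal graph has
`τ' = τ + z − τz`, `E U' = P + zμ`, `E W' = Q + zν`, `c' = c + z(μ+ν)`, `d' = (1−z)d` (memo §2b), hence apex form
`h' = 2τ'((P+zμ)(Q+zν) − (1−z)d) − (c + z(μ+ν))²`.  With `α = (1−z)(1−2τ+2τ²) + τz` and
`G = τ(1+2τ(1−τ)) + (1−τ)²z((1+4τ)(1−z) + 2(1+τ)z)` (both `≥ 0` on the unit square) the identity below holds. [this work] -/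
theorem h2_parallel_edge_identity (τ z P Q c d : ℝ) :
    4 * ((1 - z) * (1 - 2 * τ + 2 * τ ^ 2) + τ * z) * τ *
      (2 * (τ + z - τ * z) * ((P + z * (Q - c)) * (Q + z * (P - c)) - (1 - z) * d) - (c + z * ((Q - c) + (P - c))) ^ 2) =
    4 * ((1 - z) * (1 - 2 * τ + 2 * τ ^ 2) + τ * z) * (τ + z - τ * z) * (1 - z) * (2 * τ * (P * Q - d) - c ^ 2)
    + 2 * ((1 - z) * (1 - 2 * τ + 2 * τ ^ 2) + τ * z) * τ * (τ + z - τ * z) * z * (1 - z) * ((Q - c) - (P - c)) ^ 2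
    + z * (2 * ((1 - z) * (1 - 2 * τ + 2 * τ ^ 2) + τ * z) * c + 2 * τ * (2 * (τ + z - τ * z) - 1) * ((Q - c) + (P - c))) ^ 2
    + 2 * τ * z * (1 - z) * (τ * (1 + 2 * τ * (1 - τ)) + (1 - τ) ^ 2 * z * ((1 + 4 * τ) * (1 - z) + 2 * (1 + τ) * z))
        * ((Q - c) + (P - c)) ^ 2 := by
  ring

/-- **`H2` is preserved by an extra apex edge.**  If `0 < τ ≤ 1`, `0 ≤ z ≤ 1` and the apex form of `(H; y,v)` is
nonnegative at the given loads (`c² ≤ 2τ(PQ − d)`), then so is the apex form of `H` plus an edge `y–v` of weight `z`: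
`(c + z(μ+ν))² ≤ 2τ'((P+zμ)(Q+zν) − (1−z)d)`.  (Only the pointwise hypothesis is needed here.) [this work] -/
theorem h2_parallel_edge (τ z P Q c d : ℝ) (hτ0 : 0 < τ) (hτ1 : τ ≤ 1) (hz0 : 0 ≤ z) (hz1 : z ≤ 1)
    (h : c ^ 2 ≤ 2 * τ * (P * Q - d)) :
    (c + z * ((Q - c) + (P - c))) ^ 2 ≤
      2 * (τ + z - τ * z) * ((P + z * (Q - c)) * (Q + z * (P - c)) - (1 - z) * d) := by
  have hid := h2_parallel_edge_identity τ z P Q c d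
  have hh : 0 ≤ 2 * τ * (P * Q - d) - c ^ 2 := by linarith
  -- name the atoms so that `positivity` sees their signs
  set omz := 1 - z with homz
  have homz0 : 0 ≤ omz := by rw [homz]; linarith
  set omt := 1 - τ with homt
  have homt0 : 0 ≤ omt := by rw [homt]; linarith
  set q₀ := 1 - 2 * τ + 2 * τ ^ 2 with hq₀
  have hq₀0 : 0 < q₀ := by rw [hq₀]; nlinarith [sq_nonneg (2 * τ - 1)]
  set α := omz * q₀ + τ * z with hαdef
  have hα : 0 < α := by
    rw [hαdef]
    have h1 : 0 ≤ omz * q₀ := mul_nonneg homz0 hq₀0.le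
    rcases eq_or_lt_of_le hz0 with hz | hz
    · have homz1 : omz = 1 := by rw [homz, ← hz]; ring
      rw [homz1, ← hz]; linarith
    · have h2 : 0 < τ * z := mul_pos hτ0 hz
      linarith
  set τ' := τ + z - τ * z with hτ'def
  have hτ' : 0 ≤ τ' := by
    rw [hτ'def]
    have : 0 ≤ τ * omz := mul_nonneg hτ0.le homz0
    have e : τ + z - τ * z = τ * omz + z := by rw [homz]; ring
    rw [e]; linarith
  set G := τ * (1 + 2 * τ * omt) + omt ^ 2 * z * ((1 + 4 * τ) * omz + 2 * (1 + τ) * z) with hGdef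
  have hG : 0 ≤ G := by rw [hGdef]; positivity
  set e₀ := 2 * τ * (P * Q - d) - c ^ 2 with he₀
  set X := 2 * τ' * ((P + z * (Q - c)) * (Q + z * (P - c)) - omz * d) - (c + z * ((Q - c) + (P - c))) ^ 2 with hX
  -- the identity, with the atoms
  have hid' : 4 * α * τ * X =
      4 * α * τ' * omz * e₀ + 2 * α * τ * τ' * z * omz * ((Q - c) - (P - c)) ^ 2
      + z * (2 * α * c + 2 * τ * (2 * τ' - 1) * ((Q - c) + (P - c))) ^ 2
      + 2 * τ * z * omz * G * ((Q - c) + (P - c)) ^ 2 := by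
    rw [hX, hαdef, hτ'def, hGdef, he₀, homz, homt, hq₀]
    ring
  have r1 : 0 ≤ 4 * α * τ' * omz * e₀ := by positivity
  have r2 : 0 ≤ 2 * α * τ * τ' * z * omz * ((Q - c) - (P - c)) ^ 2 := by positivity
  have r3 : 0 ≤ z * (2 * α * c + 2 * τ * (2 * τ' - 1) * ((Q - c) + (P - c))) ^ 2 := by positivity
  have r4 : 0 ≤ 2 * τ * z * omz * G * ((Q - c) + (P - c)) ^ 2 := by positivity
  have hprod : 0 ≤ 4 * α * τ * X := by rw [hid']; linarith
  have hpos : 0 < 4 * α * τ := by positivity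
  have hX0 : 0 ≤ X := by
    by_contra hneg
    have hlt : X < 0 := lt_of_not_ge hneg
    have := mul_neg_of_pos_of_neg hpos hlt
    linarith
  rw [hX] at hX0
  linarith

/-! ### Percolation form of `H2 ⟹ (PV-signed)` -/

section Perc

variable {V : Type*} [Fintype V] (w : Sym2 V → unitInterval) (S : Set V) (v : V)

/-- **`H2` at the apex pair gives (PV) with the sharp constant 2, for signed loads (percolation form).**  In the event sums of
`pv_four_of_n1`: if for every real `t`
`(Σ_y ℓ_y μ(S~v ∩ S~y) + t μ(S~v))² ≤ 2 μ(S~v)·[(Σ_x ℓ_x μ(S~x) + t)(Σ_y ℓ_y μ(S~v ∩ S~y) + Σ_y ℓ_y μ(v↔y ∩ S≁v) + t μ(S~v))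
  − Σ_{x,y} ℓ_xℓ_y μ(S~x ∩ v↔y ∩ S≁v) − t Σ_y ℓ_y μ(v↔y ∩ S≁v)]`
— the apex form `H2`: `(E[ℓ(C_S); S~v])² ≤ 2 μ(S~v)(E ℓ(C_S)·E ℓ(C_v) − E[ℓ(C_S)ℓ(C_v); S≁v])` for the loads `ℓ` plus `t` on
the glued apex — then `N² ≤ 2 p_v Γ`, i.e. `Cov(1[S~v],A)² ≤ 2 μ(S~v)·(−Cov(A,Z_v))`: the per-vertex inequality (PV) of gen 42/44
at `v`, with no sign assumption on `ℓ` ((PV-signed)). [this work] -/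
theorem pv_signed_of_h2 (ℓ : V → ℝ)
    (hH2 : ∀ t : ℝ,
      ((∑ y, ℓ y * (prodBernoulli w).real ((⋃ u ∈ S, (openConn u v : Set (BondConfig V))) ∩
            ⋃ u ∈ S, (openConn u y : Set (BondConfig V)))) +
          t * (prodBernoulli w).real (⋃ u ∈ S, (openConn u v : Set (BondConfig V)))) ^ 2 ≤
      2 * (prodBernoulli w).real (⋃ u ∈ S, (openConn u v : Set (BondConfig V))) *
        ((((∑ x, ℓ x * (prodBernoulli w).real (⋃ u ∈ S, (openConn u x : Set (BondConfig V)))) + t) *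
            ((∑ y, ℓ y * (prodBernoulli w).real ((⋃ u ∈ S, (openConn u v : Set (BondConfig V))) ∩
                ⋃ u ∈ S, (openConn u y : Set (BondConfig V)))) +
              (∑ y, ℓ y * (prodBernoulli w).real ((openConn v y : Set (BondConfig V)) ∩
                (⋃ u ∈ S, (openConn u v : Set (BondConfig V)))ᶜ)) +
              t * (prodBernoulli w).real (⋃ u ∈ S, (openConn u v : Set (BondConfig V)))))
          - (∑ x, ∑ y, ℓ x * ℓ y * (prodBernoulli w).real ((⋃ u ∈ S, (openConn u x : Set (BondConfig V))) ∩
              (openConn v y : Set (BondConfig V)) ∩ (⋃ u ∈ S, (openConn u v : Set (BondConfig V)))ᶜ))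
          - t * ∑ y, ℓ y * (prodBernoulli w).real ((openConn v y : Set (BondConfig V)) ∩
              (⋃ u ∈ S, (openConn u v : Set (BondConfig V)))ᶜ))) :
    (∑ x, ℓ x * ((prodBernoulli w).real ((⋃ u ∈ S, (openConn u v : Set (BondConfig V))) ∩
            (⋃ u ∈ S, (openConn u x : Set (BondConfig V)))) -
          (prodBernoulli w).real (⋃ u ∈ S, (openConn u v : Set (BondConfig V))) *
            (prodBernoulli w).real (⋃ u ∈ S, (openConn u x : Set (BondConfig V))))) ^ 2 ≤
      2 * (prodBernoulli w).real (⋃ u ∈ S, (openConn u v : Set (BondConfig V))) *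
        ∑ x, ∑ y, ℓ x * ℓ y *
          ((prodBernoulli w).real (⋃ u ∈ S, (openConn u x : Set (BondConfig V))) *
              (prodBernoulli w).real ((openConn v y : Set (BondConfig V)) ∩ (⋃ u ∈ S, (openConn u v : Set (BondConfig V)))ᶜ) -
            (prodBernoulli w).real ((⋃ u ∈ S, (openConn u x : Set (BondConfig V))) ∩ (openConn v y : Set (BondConfig V))
              ∩ (⋃ u ∈ S, (openConn u v : Set (BondConfig V)))ᶜ)) :=
  pv_signed_of_h2_alg Finset.univ ℓ (fun x => (prodBernoulli w).real (⋃ u ∈ S, (openConn u x : Set (BondConfig V))))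
    (fun y => (prodBernoulli w).real ((⋃ u ∈ S, (openConn u v : Set (BondConfig V))) ∩ ⋃ u ∈ S, (openConn u y : Set (BondConfig V))))
    (fun y => (prodBernoulli w).real ((openConn v y : Set (BondConfig V)) ∩ (⋃ u ∈ S, (openConn u v : Set (BondConfig V)))ᶜ))
    (fun x y => (prodBernoulli w).real ((⋃ u ∈ S, (openConn u x : Set (BondConfig V))) ∩ (openConn v y : Set (BondConfig V))
      ∩ (⋃ u ∈ S, (openConn u v : Set (BondConfig V)))ᶜ))
    _ hH2

end Perc

/-! ### Appendix (gen 45, second landing): the `v`-load form — (PV-signed) as "BK deficit ≥ ½·P(y~v)·(E ℓ(C_v))²"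

The bordered matrix `[[2S,p],[pᵀ,τ]]` has THREE useful Schur faces.  Besides the apex face (`2τF ≥ c̄²`, this file) and the
apex-load-optimised face ((PV-signed) `2τΓ ≥ N²`), optimising over a load on the SECOND terminal `v` gives the cleanest
form of the conjecture: for every signed `ℓ`,
  `E[ℓ(C_y)ℓ(C_v); y≁v] ≤ E ℓ(C_y)·E ℓ(C_v) − ½·P(y~v)·(E ℓ(C_v))²`,   i.e. `2F ≥ τ Q²`
— the disjoint-clusters (BK) deficit is at least half the connection probability times the squared mean load of the second
cluster.  As families over all loads the three faces coincide; the two identities below make the passage explicit (memo §0). [this work] -/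

/-- **`v`-load shift of the apex form.**  An extra load `t` on `v` replaces `(P, Q, c, d)` by `(P + τt, Q + t, c + τt, d + t(P − c))`
(`v ∈ C_v` always, `v ∈ C_y` iff `y~v`, and on `{y≁v}` the product gains `t·ℓ(C_y)`); the apex form `h = 2τ(PQ − d) − c²` becomes
`h − τ²Q² + τ²(t + Q)²`.  Hence `H2` at all `v`-loads ⟺ `2τF ≥ c² + τ²Q²` (the `v`-Schur face). [this work] -/
theorem h2_vload_shift (τ P Q c d t : ℝ) :
    2 * τ * ((P + τ * t) * (Q + t) - (d + t * (P - c))) - (c + τ * t) ^ 2 =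
      (2 * τ * (P * Q - d) - c ^ 2) - τ ^ 2 * Q ^ 2 + τ ^ 2 * (t + Q) ^ 2 := by
  ring

/-- **The half-square form and its `v`-load shift.**  With the same substitution,
`τ·(2F' − τQ'²) = (2τF − c² − τ²Q²) + (c + τt)²` where `F = PQ − d`, `F' = P'Q' − d'`.  Hence "`2F ≥ τQ²` at all `v`-loads" is the
same `v`-Schur face `2τF ≥ c² + τ²Q²`; in particular it implies `H2` (and, over all loads, (PV-signed)), and conversely. [this work] -/
theorem half_sq_vload_shift (τ P Q c d t : ℝ) :
    τ * (2 * ((P + τ * t) * (Q + t) - (d + t * (P - c))) - τ * (Q + t) ^ 2) =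
      (2 * τ * (P * Q - d) - c ^ 2 - τ ^ 2 * Q ^ 2) + (c + τ * t) ^ 2 := by
  ring

/-- **`H2` from the half-square form** (algebra): if `0 < τ` and `2((P+τt)(Q+t) − d − t(P−c)) ≥ τ(Q+t)²` for every real `t`
(the inequality `E[UW;y≁v] ≤ EU·EW − ½P(y~v)(EW)²` for the loads `ℓ + tδ_v`), then `c² + τ²Q² ≤ 2τ(PQ − d)`; in particular the apex
form `H2` holds at `ℓ`.  Proof: `t = −c/τ`. [this work] -/
theorem h2_of_half_sq (τ P Q c d : ℝ) (hτ : 0 < τ)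
    (hall : ∀ t : ℝ, τ * (Q + t) ^ 2 ≤ 2 * ((P + τ * t) * (Q + t) - (d + t * (P - c)))) :
    c ^ 2 + τ ^ 2 * Q ^ 2 ≤ 2 * τ * (P * Q - d) := by
  have hid := half_sq_vload_shift τ P Q c d (-c / τ)
  have h0 : 0 ≤ τ * (2 * ((P + τ * (-c / τ)) * (Q + -c / τ) - (d + -c / τ * (P - c))) - τ * (Q + -c / τ) ^ 2) :=
    mul_nonneg hτ.le (by linarith [hall (-c / τ)])
  have hsq : (c + τ * (-c / τ)) ^ 2 = 0 := by
    have : c + τ * (-c / τ) = 0 := by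
      field_simp
      ring
    rw [this]; ring
  linarith

/-- **The half-square form from `H2`** (converse, algebra): if `0 < τ` and the apex form holds at every `v`-load,
`(c + τt)² ≤ 2τ((P+τt)(Q+t) − d − t(P−c))` for all real `t`, then `τQ² ≤ 2(PQ − d)`:
`E[UW; y≁v] ≤ EU·EW − ½ P(y~v)(EW)²` at `ℓ`.  Proof: `t = −Q`. [this work] -/
theorem half_sq_of_h2 (τ P Q c d : ℝ) (hτ : 0 < τ)
    (hall : ∀ t : ℝ, (c + τ * t) ^ 2 ≤ 2 * τ * ((P + τ * t) * (Q + t) - (d + t * (P - c)))) :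
    τ * Q ^ 2 ≤ 2 * (P * Q - d) := by
  have hid := h2_vload_shift τ P Q c d (-Q)
  have h0 : 0 ≤ 2 * τ * ((P + τ * -Q) * (Q + -Q) - (d + -Q * (P - c))) - (c + τ * -Q) ^ 2 := by linarith [hall (-Q)]
  have hsq : τ ^ 2 * (-Q + Q) ^ 2 = 0 := by ring
  have h1 : 0 ≤ 2 * τ * (P * Q - d) - c ^ 2 - τ ^ 2 * Q ^ 2 := by linarith
  nlinarith [h1, sq_nonneg c, hτ]

end APL

end Summit.CriticalPhenomena.PercolationContinuityZ3.Theorems
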